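import Literature.Analysis.FluidPDE.StokesTorusDiagonalProofs
import HarnessLib

/-!
# The `L²`-valued Stokes operator on `T^d` is diagonal in any basis of Stokes modes (discharge)

Sibling proof file of `Literature/Analysis/FluidPDE/StokesTorus.lean`, next to
`StokesTorusDiagonalProofs.lean` (which discharges the `H`-version
`Torus.stokesOperatorH_eq_diagonalPMap`). It discharges the named fact
`Torus.stokesOperator_eq_diagonalPMap`, the `L²` corollary: for every Hilbert basis `b` of the
energy space `H = Torus.energySpace d` consisting of Stokes modes `Torus.stokesModeL2 k a c`
(`x ↦ cos(2πk·x) a`, `x ↦ sin(2πk·x) a`) with symbol `m i = 4π²|k|²`, and every `v ∈ H`,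
`v ∈ D(A) ↔ v ∈ D(diag(m))` for the `L²`-valued Stokes operator `A = Torus.stokesOperator d`
and the maximal diagonal operator `diag(m) = b.diagonalPMap m`, and `A v = diag(m) v` in `L²` on
this common domain.

Source: P. Constantin, C. Foias, *Navier–Stokes Equations* (1988), Ch. 4, periodic case,
(4.35)–(4.37): `𝒟(A) = H_{2,L} ∩ H`, `A u = ∑_k (4π²/L²)|k|² u_k w_k`,
`(A u)_k = (4π²/L²)|k|² u_k` (here `L = 1`), with (4.42) (eigenvalues `4π²|k|²/L²`,
eigenfunctions `c w_k + c̄ w_{-k}`, `⟨c, k⟩ = 0`). The fact's own docstring points at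
"(4.13)–(4.14)"; the displays carrying the statement are (4.35)–(4.37) and (4.42).

## Proof

The two carriers of the Stokes operator — `Torus.stokesOperator d : L² →ₗ.[ℝ] L²` and
`Torus.stokesOperatorH d : H →ₗ.[ℝ] H` — have the same domain and the same values
(`Torus.mem_domain_stokesOperatorH_iff`, `Torus.coe_stokesOperatorH_apply`, proved in
`StokesTorus`), and `Torus.stokesOperatorH d = b.diagonalPMap m`
(`Torus.stokesOperatorH_eq_diagonalPMap_holds` of `StokesTorusDiagonalProofs`). This is the
interim proof preserved as a comment under the fact in `StokesTorus`, now unconditional.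

No new definitions and no new named facts (D-0026).

## References

* P. Constantin, C. Foias, *Navier–Stokes Equations*, Chicago Lectures in Mathematics, Univ. of
  Chicago Press (1988), Ch. 4, (4.35)–(4.37), (4.42). [ConstantinFoias1988]
-/

noncomputable section

open MeasureTheory

namespace Literature.Analysis.FluidPDE

namespace Torus

variable {d : Type*} [Fintype d] [DecidableEq d]

/-- **The `L²`-valued Stokes operator is diagonal in any Hilbert basis of Stokes modes**
(discharge of the named fact `Torus.stokesOperator_eq_diagonalPMap`): for every Hilbert basis `b`
of `H = Torus.energySpace d` with `b i = stokesModeL2 k a c` and `m i = 4π²|k|²`, and every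
`v ∈ H`, `v ∈ D(A) ↔ v ∈ b.diagonalDomain m`, and on this common domain
`A v = b.diagonalPMap m v` in `L²` (Constantin–Foias 1988, Ch. 4, (4.35)–(4.37):
`𝒟(A) = H_{2,L} ∩ H`, `(A u)_k = (4π²/L²)|k|² u_k`; (4.42): eigenvalues `4π²|k|²/L²`,
eigenfunctions `c w_k + c̄ w_{-k}`, `⟨c, k⟩ = 0`). From the `H`-version
`stokesOperatorH_eq_diagonalPMap_holds` and the agreement of the two carriers of the Stokes
operator (`mem_domain_stokesOperatorH_iff`, `coe_stokesOperatorH_apply`).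
[cite: ConstantinFoias1988, Ch. 4 (4.35)–(4.37), (4.42)] -/
theorem stokesOperator_eq_diagonalPMap_holds : stokesOperator_eq_diagonalPMap (d := d) := by
  intro ι b m hb v
  have hAB := stokesOperatorH_eq_diagonalPMap_holds b m hb
  obtain ⟨hdom, happ⟩ := LinearPMap.ext_iff.mp hAB
  have hmem : (v : Lp (EuclideanSpace ℝ d) 2 (volume : Measure (UnitAddTorus d))) ∈
      (stokesOperator d).domain ↔ v ∈ b.diagonalDomain m := by
    rw [← mem_domain_stokesOperatorH_iff, hdom]
    rfl
  refine ⟨hmem, fun hv hv' => ?_⟩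
  have hvH : v ∈ (stokesOperatorH d).domain := (mem_domain_stokesOperatorH_iff v).mpr hv
  have h := coe_stokesOperatorH_apply (d := d) ⟨v, hvH⟩
  have h' : stokesOperatorH d ⟨v, hvH⟩ = b.diagonalPMap m ⟨v, hv'⟩ := @happ v hvH hv'
  rw [← h', h]

end Torus

end Literature.Analysis.FluidPDE
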